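import Summits.AtomisticToContinuum.HydrodynamicLimit.Theses.BoxDissipativeWeakStrong

/-!
# Route BoxDissipativeWeakStrong — `Assembly` (item stmt-AtomisticToContinuum-17724; formerly stmt-9907)

`Assembly := FluxClosure → EntropyAdmissibility → RelativeEnergyStability → LocalGibbsFineScale →
HsEosLowDensity → HydrodynamicLimit` is, verbatim, the type of the route's deciding theorem `closes`
(rev 8, 2026-08-16T23:29Z: after the statement re-type p126922 the sub-problem decl `HydrodynamicLimit`
is itself packing-guarded, so `DiluteSelfConsistency` left the chain — the rev-1 six-hypothesis
`Assembly`, stmt-AtomisticToContinuum-9907, proved here @ 34674fe2c779, was replaced 1:1 by the current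
five-hypothesis one, and the old proof script stopped elaborating). The proof is the deciding theorem
itself: `closes h1 h2 h3 h0 hE` — pure quantifier bookkeeping (`RelativeEnergyStability` fed with the two
closure statements, the fine-scale initial LLN and the equation-of-state fact gives a threshold `η_c > 0`
and the packing-guarded limit on every band `η₁ < η_c`; `closes` takes `η₀ := η_c/4`, band `η_c/2`).
The theorem keeps its name and statement text (Theorems files are append-only); only the proof term
changed (dependency-drift repair 2026-08-17, fix prepared by literature-prover-litprove-pool-A-g73-0).

References: BrezinaFeireisl2018 (the weak–strong uniqueness engine behind
`RelativeEnergyStability`), Spohn1991 Part I Ch. 3 (the statement of the hydrodynamic limit).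
-/

namespace Summit.AtomisticToContinuum.HydrodynamicLimit.Theorems

open Summit.AtomisticToContinuum.HydrodynamicLimit.Theses in
/-- The assembly item of route BoxDissipativeWeakStrong (stmt-AtomisticToContinuum-17724):
`FluxClosure → EntropyAdmissibility → RelativeEnergyStability → LocalGibbsFineScale →
HsEosLowDensity → HydrodynamicLimit` — literally the type of the route's deciding theorem
`BoxDissipativeWeakStrong.closes`, which proves it (`η₀ := η_c/4`, band `η₁ := η_c/2`, the Statement's
own packing guard feeding the guarded limit of `RelativeEnergyStability`). [folklore] -/
theorem boxDissipativeWeakStrong_assembly_proof :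
    Summit.AtomisticToContinuum.HydrodynamicLimit.Theses.BoxDissipativeWeakStrong.Assembly :=
  fun h1 h2 h3 h0 hE => BoxDissipativeWeakStrong.closes h1 h2 h3 h0 hE

end Summit.AtomisticToContinuum.HydrodynamicLimit.Theorems
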